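import Summits.BirchSwinnertonDyer.BirchSwinnertonDyer.Theorems.PrintX10bMuPartOfPrintKSOfStubs
import Summits.BirchSwinnertonDyer.BirchSwinnertonDyer.Theorems.PrintX10bStubAExactAtP
import Summits.BirchSwinnertonDyer.BirchSwinnertonDyer.Theorems.PrintX9MuPartStubH5bAtSZeroPClosed
import Summits.BirchSwinnertonDyer.BirchSwinnertonDyer.Theorems.PrintX10bStubReadoutSelmerKS
import Summits.BirchSwinnertonDyer.BirchSwinnertonDyer.Theorems.PrintX10bStubReadoutLocalClausesKS
import Summits.BirchSwinnertonDyer.BirchSwinnertonDyer.Theorems.PrintX9KummerStrictOnFrames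
import HarnessLib

/-!
# The L∃ letter of the shared μ-crux from the TWO print leaves F-161 / F-411 ONLY — the leaf G-2.4
# (Greenberg LNM 1716 Prop. 2.4) discharged on the frames (road CG-FRAME, closed letter; route-free)

Cell `pub/bsd-print-x9`, item stmt-BirchSwinnertonDyer-23237 `MuInequalityCoherentPairOfPrint` (routes `PrintX9` /
`PrintX10b`; = the shared deciding μ-crux 23428 `MuInequalityCoherentPairOfPrintCG` WITHOUT its third cite-only leaf
hCG = `Greenberg1999.imKummer_eq_strictCondition_goodOrdinary_numberField`).  THEOREMS ONLY; NO route file is imported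
(the by-name closers `… : Theses.PrintX9.MuInequalityCoherentPairOfPrint` / `…PrintX10b…` are the one-line wrappers of
the theorem below, filed separately).

`muPartStabilizedCoherentPair_of_thm161_thm411 : thm161_dvrKolyvaginBound → thm411_exists_kolyvaginSystem_one_ne_zero →
HeegnerMuPartStabilized.MuPartStabilizedCoherentPair` — GIVEN, BY NAME, Howard 2004 Thm. 1.6.1 (F-161) and
Castella–Grossi–Lee–Skinner 2022 Thm. 4.1.1 with Rem. 4.1.4 (F-411), the L∃ letter holds: on every μ-frame there are a
stabilised Heegner datum and a coherent Howard family whose μ/characteristic-ideal inequality at the Eisenstein primes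
`𝔮_m = (T^m + p)` holds m-uniformly.  Assembly (x10b-p1 LEAD g10's KS-chain F1–F5 = the 23428 reduction certificate with
the leaf hCG replaced by the frame-restricted letter `HeegnerMuPartControlGlue.Stmt.kummerStrictOnFrames`):
`HeegnerMuPartOfPrintKS.muPartStabilizedCoherentPair_of_thm161_thm411_ks` fed with
`HeegnerMuPartStubA.howardInputs_of_exactAtP_of_clauseZeroP stub_exactAtP stub_h5bAtSZeroP` (D1's Eisenstein DVR settings,
(Exact) and H.5(b) at `v ∣ p`), `HeegnerMuPartControlGlue.controlGlueKS_of_clauses stub_readoutSelmerKS stub_readoutIndexKS`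
(the discrete/compact control (B4)/(B5) in KS form) and the KERNEL THEOREM
`HeegnerMuPartControlGlue.kummerStrictOnFrames_holds` (file `PrintX9KummerStrictOnFrames`: Kummer = strict at `H = ker κ⁻`
on the frames, from (A) Greenberg Prop. 2.2 (i), (D) the formal Tate direction, (C) `H¹((ker κ⁻)_v, E₁(K̄_v)) = 0` over
Coates–Greenberg Cor. 3.2 for the cyclotomic kernel (Tate's almost étale lemma), the unit-trace element of an unramified
quotient and «`K̃_∞/K_∞⁻` unramified above split `p`» — nine seats of the cell, 2026-08-29T00:30–01:30Z).
HONEST FRAMING: the two leaves F-161 / F-411 remain HYPOTHESES (statement-only Literature facts); the third leaf of the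
round-3 crux is now a kernel theorem ON THESE FRAMES ONLY; no summit statement is proved; BSD is NOT proved by this file
or by anything it imports; «beyond-print theorem»: no.

References: [Howard2004HeegnerKolyvagin] Thm. 1.6.1, Prop. 2.2.8, proof of Thm. 2.2.10; [CastellaGrossiLeeSkinner2022]
Thm. 4.1.1, Rem. 4.1.4; [GreenbergLNM1716] Prop. 2.2 (i), Prop. 2.4; [CoatesGreenberg1996] Cor. 3.2, Prop. 4.3.
-/

set_option linter.dupNamespace false
set_option autoImplicit false

namespace Summit.BirchSwinnertonDyer.BirchSwinnertonDyer.Theorems.HeegnerMuPartOfPrintKSClosed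

open Summit.BirchSwinnertonDyer.BirchSwinnertonDyer.Theorems

/-- **The stub-A letter `Stmt.howardInputs`** (Howard's (H.0)–(H.5) + `LargePrimes` + the pushed-forward Kolyvagin system for
the Eisenstein DVR settings `S_m`), from the two registered μ-crux stubs (Exact) at `v ∣ p` (`HeegnerMuPartH4AtS.stub_exactAtP`)
and H.5(b) at `v ∣ p` (`HeegnerMuPartH5bAtS.stub_h5bAtSZeroP`). [cite: Howard2004HeegnerKolyvagin, §1.3 (H.0)–(H.5), Thm. 1.6.1] -/
theorem howardInputs_holds : HeegnerMuPartStubA.Stmt.howardInputs :=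
  HeegnerMuPartStubA.howardInputs_of_exactAtP_of_clauseZeroP HeegnerMuPartH4AtS.stub_exactAtP
    HeegnerMuPartH5bAtS.stub_h5bAtSZeroP

/-- **The KS control-glue letter `Stmt.controlGlueKS`** (m-uniform control of the Selmer pair up `K_∞/K`, leading binder the
frame-restricted Kummer = strict letter instead of the leaf hCG), from its two clauses (B4) `stub_readoutSelmerKS` and (B5)
`stub_readoutIndexKS`. [cite: Howard2004HeegnerKolyvagin, Prop. 2.2.8 and proof of Thm. 2.2.10] [cite: GreenbergLNM1716, Prop. 2.4] -/
theorem controlGlueKS_holds : HeegnerMuPartControlGlue.Stmt.controlGlueKS :=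
  HeegnerMuPartControlGlue.controlGlueKS_of_clauses HeegnerMuPartControlGlue.stub_readoutSelmerKS
    HeegnerMuPartControlGlue.stub_readoutIndexKS

/-- **The L∃ letter from the two print leaves F-161 and F-411 alone** (route-free form of item stmt-BirchSwinnertonDyer-23237):
Howard Thm. 1.6.1 ⟹ CGLS Thm. 4.1.1 ⟹ `HeegnerMuPartStabilized.MuPartStabilizedCoherentPair`; the third leaf of the round-3
crux (Greenberg Prop. 2.4) is supplied by the kernel theorem `HeegnerMuPartControlGlue.kummerStrictOnFrames_holds`.
[cite: Howard2004HeegnerKolyvagin, Thm. 1.6.1 and proof of Thm. 2.2.10] [cite: CastellaGrossiLeeSkinner2022, Thm. 4.1.1, Rem. 4.1.4]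
[cite: GreenbergLNM1716, Prop. 2.4 (discharged on the frames)] -/
theorem muPartStabilizedCoherentPair_of_thm161_thm411 :
    Literature.NumberTheory.GaloisCohomology.Howard2004.thm161_dvrKolyvaginBound →
      Literature.NumberTheory.EllipticCurves.CastellaGrossiLeeSkinner2022.thm411_exists_kolyvaginSystem_one_ne_zero →
        HeegnerMuPartStabilized.MuPartStabilizedCoherentPair :=
  fun h161 h411 ↦ HeegnerMuPartOfPrintKS.muPartStabilizedCoherentPair_of_thm161_thm411_ks howardInputs_holds
    controlGlueKS_holds h161 h411 HeegnerMuPartControlGlue.kummerStrictOnFrames_holds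

end Summit.BirchSwinnertonDyer.BirchSwinnertonDyer.Theorems.HeegnerMuPartOfPrintKSClosed
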